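import Summits.KontsevichZagierPeriods.KontsevichZagierPeriods.Theses.FermatIsogeny
import Summits.KontsevichZagierPeriods.KontsevichZagierPeriods.Theorems.FermatIsogenyBetaLinearSectorSixthsNormalForms
import Summits.KontsevichZagierPeriods.KontsevichZagierPeriods.Theorems.FermatIsogenyBetaLinearSectorQuarters
import Literature.NumberTheory.Transcendental.KZRelationsLE
import HarnessLib

/-!
# `BetaLinearSector` at level `6` — the RUNG from the normal form of the ten upper cells

Support file of crux `BetaLinearSector` (stmt-KontsevichZagierPeriods-3897, route FermatIsogeny), registered anchor
`betaLinearSector_sixths_of_normalForm_upper`: **Conjecture 1 of Kontsevich–Zagier for every pair of Beta integrals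
`[∫₀¹ t^{a-1}(1-t)^{b-1}dt]`, `[∫₀¹ c·t^{a'-1}(1-t)^{b'-1}dt]` with parameters in `⅙ℕ_{>0}`**, from ONE hypothesis — the normal form of
the ten UPPER base cells `β(a,b)`, `a, b ∈ {1/3, 1/2, 2/3, 5/6}`, `a + b > 1` (the `π²/Γ(1/3)³`-class) onto the canonical cell
`T₃ = [β(2/3,1/2)]` — the only transcendence input being CHUDNOVSKY's theorem (`π`, `Γ(1/3)` algebraically independent, PROVED in the
tree) through the landed separation `Thirds.v_sep` of the four class values `v = (1, π, Γ(1/3)³/π, π²/Γ(1/3)³)`.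

* Part I — LEVEL REDUCTION keeping sixth-integrality (`rung6_P_of_base_left_sixth`: strong induction on `⌊a⌋ + ⌊b⌋` with the landed
  chains `P_lower_left`, `P_swap_left` of the half-integer file).
* Part II — LEVEL `6`.  The 36 base cells `a, b ∈ {1/6, 1/3, 1/2, 2/3, 5/6, 1}` (`sixth_cases`) normalise onto `(c q)·T_i` over the four
  canonical cells `T₀ = [β(1,1)]`, `T₁ = [β(1/2,1/2)]`, `T₂ = [β(1/3,1/2)]`, `T₃ = [β(2/3,1/2)]`: the 26 lower cells by the landed
  `normalForm_sixths_lower`, the 10 upper cells by the hypothesis (`rung6_normalForm`).  The VALUES of the canonical cells are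
  `κ_i v_i` with the algebraic factors `κ = (1, 1, √3/2^{4/3}, 2^{7/3})`: `B(1/3,1/2) = (√3/2^{4/3})·Γ(1/3)³/π` (Legendre's duplication
  at `1/3` and Euler's reflection at `1/3`) and `B(2/3,1/2) = 2^{7/3}·π²/Γ(1/3)³` (`Γ(7/6) = Γ(1/6)/6`, duplication at `1/6`, reflection)
  — `rung6_beta_13_12`, `rung6_beta_23_12`.  Assembly `rung6_P_base_sixth` exactly as at levels `3` and `4`: degenerate constants give two
  zero representations, two cells of the same class meet at the same multiple of the same canonical cell, two cells of different classes
  never share a value (`v_sep`).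

References: M. Kontsevich, D. Zagier, *Periods* (2001), §1.2; G. V. Chudnovsky, *Contributions to the theory of transcendental numbers*
(1984), Ch. 7 §2 Cor. 2.3; G. E. Andrews, R. Askey, R. Roy, *Special Functions* (1999), §1.1, Thm 1.5.1 (duplication), Thm 1.2.1
(reflection).
-/

noncomputable section

namespace Summit.KontsevichZagierPeriods.FermatIsogeny.BetaLinearSector.Sixths

open MeasureTheory Set Literature.NumberTheory.Transcendental Literature.NumberTheory.Transcendental.KZ HalfIntegers
open Literature.Analysis.SpecialFunctions (Gamma_one_sixth_mul_Gamma_two_thirds)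
open Summit.KontsevichZagierPeriods.FermatIsogeny.BetaLinearSector.Thirds (v_pos v_sep cast_third thirds_Gamma_two_thirds_eq)
open Summit.KontsevichZagierPeriods.FermatIsogeny.BetaLinearSector.Quarters (cast_half)
open Summit.KontsevichZagierPeriods.KontsevichZagierPeriods.Theorems.GKZLevelThree (isAlgebraic_sqrt_three)

set_option quotPrecheck false in
/-- `r` is PINNED as `[(0,1), c · t^{a-1}(1-t)^{b-1}]` (the two hypotheses on each representation in the crux, with a constant). -/
local notation "Pinned⟦" c ", " a ", " b ", " r "⟧" =>
  (IntegralRep.domain r = {x : Fin 1 → ℝ | x 0 ∈ Set.Ioo (0:ℝ) 1} ∧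
    Set.EqOn (IntegralRep.integrand r) (fun x : Fin 1 → ℝ => (c : ℝ) * (x 0) ^ (((a : ℚ) : ℝ) - 1) * (1 - x 0) ^ (((b : ℚ) : ℝ) - 1))
      (IntegralRep.domain r))

set_option quotPrecheck false in
/-- The two-sided, constant-carrying form of the crux for fixed exponents: any two representations pinned as `[c·β(a,b)]`,
`[c'·β(a',b')]` (`c, c'` real algebraic) with equal values are KZ-equivalent. -/
local notation "P⟦" a ", " b ", " a' ", " b' "⟧" =>
  (∀ (c c' : ℝ) (r r' : IntegralRep 1), IsAlgebraic ℚ c → IsAlgebraic ℚ c' →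
    Pinned⟦c, a, b, r⟧ → Pinned⟦c', a', b', r'⟧ → IntegralRep.value r = IntegralRep.value r' → Equivalent r r')

set_option quotPrecheck false in
/-- THE HYPOTHESIS of the rung: the NORMAL FORM OF THE TEN UPPER CELLS — every cell `[c·β(a,b)]`, `a, b ∈ {1/3, 1/2, 2/3, 5/6}`,
`a + b > 1`, is a chain of moves away from `(c q)·T`, `q > 0`, `c q` real algebraic, for any cell `T` pinned as `[β(2/3,1/2)]`. -/
local notation "UpperNF" =>
  (∀ (c : ℝ), IsAlgebraic ℚ c → ∀ (a b : ℚ),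
      (a = 1 / 3 ∨ a = 1 / 2 ∨ a = 2 / 3 ∨ a = 5 / 6) → (b = 1 / 3 ∨ b = 1 / 2 ∨ b = 2 / 3 ∨ b = 5 / 6) → 1 < a + b →
      ∀ (r T : KZ.IntegralRep 1),
      (r.domain = {x | x 0 ∈ Set.Ioo (0:ℝ) 1} ∧
        Set.EqOn r.integrand (fun x => c * (x 0) ^ ((a:ℝ) - 1) * (1 - x 0) ^ ((b:ℝ) - 1)) r.domain) →
      (T.domain = {x | x 0 ∈ Set.Ioo (0:ℝ) 1} ∧
        Set.EqOn T.integrand (fun x => (1:ℝ) * (x 0) ^ (((2/3:ℚ):ℝ) - 1) * (1 - x 0) ^ (((1/2:ℚ):ℝ) - 1)) T.domain) →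
      ∃ (q : ℝ) (hk : IsAlgebraic ℚ (c * q)), 0 < q ∧ KZ.Equivalent r (T.constMul (c * q) hk))

/-! ## Part I — level reduction keeping sixth-integrality -/

/-- LEVEL REDUCTION on the left pair, KEEPING SIXTH-INTEGRALITY: if `P⟦a₀, b₀, a', b'⟧` holds for all sixth-integer exponents
`a₀, b₀ ∈ (0,1]`, it holds for all positive sixth-integers `a, b` (strong induction on `⌊a⌋ + ⌊b⌋`, translating and swapping with
the landed chains `P_lower_left`, `P_swap_left`; `b − 1` is a sixth-integer when `b` is). [folklore] -/
theorem rung6_P_of_base_left_sixth {a' b' : ℚ}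
    (base : ∀ a b : ℚ, 0 < a → a ≤ 1 → 0 < b → b ≤ 1 → (∃ m : ℤ, a = m / 6) → (∃ m : ℤ, b = m / 6) → P⟦a, b, a', b'⟧) :
    ∀ a b : ℚ, 0 < a → 0 < b → (∃ m : ℤ, a = m / 6) → (∃ m : ℤ, b = m / 6) → P⟦a, b, a', b'⟧ := by
  have hsub : ∀ {q : ℚ}, (∃ m : ℤ, q = m / 6) → ∃ m : ℤ, q - 1 = m / 6 := by
    rintro q ⟨m, rfl⟩
    exact ⟨m - 6, by push_cast; ring⟩
  suffices H : ∀ n : ℕ, ∀ a b : ℚ, ⌊a⌋₊ + ⌊b⌋₊ = n → 0 < a → 0 < b → (∃ m : ℤ, a = m / 6) → (∃ m : ℤ, b = m / 6) →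
      P⟦a, b, a', b'⟧ from
    fun a b ha hb hma hmb => H _ a b rfl ha hb hma hmb
  intro n
  induction n using Nat.strong_induction_on with
  | _ n ih =>
    intro a b hn ha hb hma hmb
    by_cases hb1 : b ≤ 1
    · by_cases ha1 : a ≤ 1
      · exact base a b ha ha1 hb hb1 hma hmb
      · push Not at ha1
        have ha' : 0 < a - 1 := by linarith
        have hfl : ⌊a⌋₊ = ⌊a - 1⌋₊ + 1 := by
          conv_lhs => rw [← sub_add_cancel a 1]
          exact Nat.floor_add_one ha'.le
        have hlt : ⌊b⌋₊ + ⌊a - 1⌋₊ < n := by omega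
        have hP : P⟦b, (a - 1), a', b'⟧ := ih _ hlt b (a - 1) rfl hb ha' hmb (hsub hma)
        have hP' : P⟦b, a, a', b'⟧ := by simpa using P_lower_left hb ha' hP
        exact P_swap_left ha hb hP'
    · push Not at hb1
      have hb' : 0 < b - 1 := by linarith
      have hfl : ⌊b⌋₊ = ⌊b - 1⌋₊ + 1 := by
        conv_lhs => rw [← sub_add_cancel b 1]
        exact Nat.floor_add_one hb'.le
      have hlt : ⌊a⌋₊ + ⌊b - 1⌋₊ < n := by omega
      have hP : P⟦a, (b - 1), a', b'⟧ := ih _ hlt a (b - 1) rfl ha hb' hma (hsub hmb)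
      simpa using P_lower_left ha hb' hP

/-- The UPPER cells among the base cells: if `a, b ∈ {1/6, …, 1}` and NOT (`a + b ≤ 1` or `a = 1` or `b = 1`), then
`a, b ∈ {1/3, 1/2, 2/3, 5/6}` and `a + b > 1`. [folklore] -/
theorem rung6_upper_cases {a b : ℚ} (ha : a = 1 / 6 ∨ a = 1 / 3 ∨ a = 1 / 2 ∨ a = 2 / 3 ∨ a = 5 / 6 ∨ a = 1)
    (hb : b = 1 / 6 ∨ b = 1 / 3 ∨ b = 1 / 2 ∨ b = 2 / 3 ∨ b = 5 / 6 ∨ b = 1) (h : ¬ (a + b ≤ 1 ∨ a = 1 ∨ b = 1)) :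
    (a = 1 / 3 ∨ a = 1 / 2 ∨ a = 2 / 3 ∨ a = 5 / 6) ∧ (b = 1 / 3 ∨ b = 1 / 2 ∨ b = 2 / 3 ∨ b = 5 / 6) ∧ 1 < a + b := by
  revert h
  rcases ha with rfl | rfl | rfl | rfl | rfl | rfl <;> rcases hb with rfl | rfl | rfl | rfl | rfl | rfl <;> norm_num

/-! ## Part II — the canonical cells: the algebraic factors `κ` and the values `κ_i v_i` -/

set_option quotPrecheck false in
/-- The four CLASS VALUES `v = (1, π, Γ(1/3)³/π, π²/Γ(1/3)³)` of the level-`3` file (a notation, not a definition). -/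
local notation "v" => (![1, Real.pi, Real.Gamma (1/3) ^ 3 / Real.pi, Real.pi ^ 2 / Real.Gamma (1/3) ^ 3] : Fin 4 → ℝ)

set_option quotPrecheck false in
/-- The ALGEBRAIC FACTORS `κ = (1, 1, √3/2^{4/3}, 2^{7/3})` of the values `B(1,1)`, `B(1/2,1/2)`, `B(1/3,1/2)`, `B(2/3,1/2)` of the
canonical cells relative to `v` (a notation, not a definition). -/
local notation "κ" => (![1, 1, Real.sqrt 3 / (2 * (2:ℝ) ^ (1/3:ℝ)), 4 * (2:ℝ) ^ (1/3:ℝ)] : Fin 4 → ℝ)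

/-- `Γ(5/6) = 2^{1/3}√π·Γ(2/3)/Γ(1/3)` — Legendre's duplication `Γ(s)Γ(s+1/2) = Γ(2s)2^{1-2s}√π` at `s = 1/3`.
[cite: AndrewsAskeyRoy1999, Thm 1.5.1] -/
theorem rung6_Gamma_five_sixths :
    Real.Gamma (1 / 3 + 1 / 2) = Real.Gamma (2 / 3) * (2:ℝ) ^ (1 / 3 : ℝ) * Real.sqrt Real.pi / Real.Gamma (1 / 3) := by
  have h13 : Real.Gamma (1 / 3) ≠ 0 := (Real.Gamma_pos_of_pos (by norm_num)).ne'
  have hdup := Real.Gamma_mul_Gamma_add_half (1 / 3 : ℝ)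
  rw [show 2 * (1 / 3 : ℝ) = 2 / 3 by norm_num, show (1 : ℝ) - 2 / 3 = 1 / 3 by norm_num] at hdup
  rw [eq_div_iff h13]
  linear_combination hdup

/-- `B(1/3,1/2) = Γ(1/3)Γ(1/2)/Γ(5/6) = (√3/2^{4/3})·Γ(1/3)³/π` (duplication at `1/3`, reflection `Γ(1/3)Γ(2/3) = 2π/√3`,
`Γ(1/2) = √π`). [cite: AndrewsAskeyRoy1999, Thm 1.5.1] -/
theorem rung6_beta_13_12 :
    Real.Gamma (1 / 3) * Real.Gamma (1 / 2) / Real.Gamma (1 / 3 + 1 / 2) =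
      Real.sqrt 3 / (2 * (2:ℝ) ^ (1 / 3 : ℝ)) * (Real.Gamma (1 / 3) ^ 3 / Real.pi) := by
  have h13 : Real.Gamma (1 / 3) ≠ 0 := (Real.Gamma_pos_of_pos (by norm_num)).ne'
  have hsπ : Real.sqrt Real.pi ≠ 0 := (Real.sqrt_pos.2 Real.pi_pos).ne'
  have hs3 : Real.sqrt 3 ≠ 0 := (Real.sqrt_pos.2 (by norm_num)).ne'
  have ht : (2:ℝ) ^ (1 / 3 : ℝ) ≠ 0 := (Real.rpow_pos_of_pos two_pos _).ne'
  have hπ : Real.pi ≠ 0 := Real.pi_ne_zero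
  rw [rung6_Gamma_five_sixths, Real.Gamma_one_half_eq, thirds_Gamma_two_thirds_eq]
  field_simp

/-- `Γ(1/6) = 2^{2/3}√π·Γ(1/3)/Γ(2/3)` — Legendre's duplication at `s = 1/6` (the tree's `Gamma_one_sixth_mul_Gamma_two_thirds`).
[cite: AndrewsAskeyRoy1999, Thm 1.5.1] -/
theorem rung6_Gamma_one_sixth :
    Real.Gamma (1 / 6) = Real.Gamma (1 / 3) * (2:ℝ) ^ (2 / 3 : ℝ) * Real.sqrt Real.pi / Real.Gamma (2 / 3) := by
  have h23 : Real.Gamma (2 / 3) ≠ 0 := (Real.Gamma_pos_of_pos (by norm_num)).ne'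
  rw [eq_div_iff h23]
  exact Gamma_one_sixth_mul_Gamma_two_thirds

/-- `2^{1/3} · 2^{2/3} = 2`. [folklore] -/
theorem rung6_two_rpow_third_mul_twoThirds : (2:ℝ) ^ (1 / 3 : ℝ) * (2:ℝ) ^ (2 / 3 : ℝ) = 2 := by
  rw [← Real.rpow_add two_pos]
  norm_num

/-- `B(2/3,1/2) = Γ(2/3)Γ(1/2)/Γ(7/6) = 2^{7/3}·π²/Γ(1/3)³` (`Γ(7/6) = Γ(1/6)/6`, duplication at `1/6`, reflection
`Γ(2/3) = 2π/(√3Γ(1/3))`, `Γ(1/2) = √π`). [cite: AndrewsAskeyRoy1999, Thm 1.5.1] -/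
theorem rung6_beta_23_12 :
    Real.Gamma (2 / 3) * Real.Gamma (1 / 2) / Real.Gamma (2 / 3 + 1 / 2) =
      4 * (2:ℝ) ^ (1 / 3 : ℝ) * (Real.pi ^ 2 / Real.Gamma (1 / 3) ^ 3) := by
  have h13 : Real.Gamma (1 / 3) ≠ 0 := (Real.Gamma_pos_of_pos (by norm_num)).ne'
  have hsπ : Real.sqrt Real.pi ≠ 0 := (Real.sqrt_pos.2 Real.pi_pos).ne'
  have hs3 : Real.sqrt 3 ≠ 0 := (Real.sqrt_pos.2 (by norm_num)).ne'
  have ht : (2:ℝ) ^ (1 / 3 : ℝ) ≠ 0 := (Real.rpow_pos_of_pos two_pos _).ne'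
  have ht2 : (2:ℝ) ^ (2 / 3 : ℝ) ≠ 0 := (Real.rpow_pos_of_pos two_pos _).ne'
  have hπ : Real.pi ≠ 0 := Real.pi_ne_zero
  have h33 : Real.sqrt 3 ^ 2 = 3 := Real.sq_sqrt (by norm_num)
  have h12 := rung6_two_rpow_third_mul_twoThirds
  rw [show (2 / 3 : ℝ) + 1 / 2 = 1 / 6 + 1 by norm_num, Real.Gamma_add_one (by norm_num : (1 / 6 : ℝ) ≠ 0),
    rung6_Gamma_one_sixth, Real.Gamma_one_half_eq, thirds_Gamma_two_thirds_eq]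
  field_simp
  linear_combination (-8) * h33 + (-4 * Real.sqrt 3 ^ 2) * h12

/-- Value of `T₀ = [β(1,1)]`: `κ₀ v₀ = 1`. [cite: AndrewsAskeyRoy1999, Thm 1.1.4] -/
theorem rung6_value_T0 {T : IntegralRep 1} (hT : Pinned⟦(1:ℝ), (1:ℚ), (1:ℚ), T⟧) : T.value = κ 0 * v 0 := by
  rw [value_of_pinned hT (by norm_num) (by norm_num)]
  norm_num [Real.Gamma_one, Real.Gamma_two]

/-- Value of `T₁ = [β(1/2,1/2)]`: `κ₁ v₁ = π`. [cite: AndrewsAskeyRoy1999, Thm 1.1.4] -/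
theorem rung6_value_T1 {T : IntegralRep 1} (hT : Pinned⟦(1:ℝ), (1/2:ℚ), (1/2:ℚ), T⟧) : T.value = κ 1 * v 1 := by
  rw [value_half_half hT]
  simp

/-- Value of `T₂ = [β(1/3,1/2)]`: `κ₂ v₂ = (√3/2^{4/3})·Γ(1/3)³/π`. [cite: AndrewsAskeyRoy1999, Thm 1.5.1] -/
theorem rung6_value_T2 {T : IntegralRep 1} (hT : Pinned⟦(1:ℝ), (1/3:ℚ), (1/2:ℚ), T⟧) : T.value = κ 2 * v 2 := by
  rw [value_of_pinned hT (by norm_num) (by norm_num), cast_third, cast_half, rung6_beta_13_12]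
  simp

/-- Value of `T₃ = [β(2/3,1/2)]`: `κ₃ v₃ = 2^{7/3}·π²/Γ(1/3)³`. [cite: AndrewsAskeyRoy1999, Thm 1.5.1] -/
theorem rung6_value_T3 {T : IntegralRep 1} (hT : Pinned⟦(1:ℝ), (2/3:ℚ), (1/2:ℚ), T⟧) : T.value = κ 3 * v 3 := by
  rw [value_of_pinned hT (by norm_num) (by norm_num), Thirds.cast_twoThirds, cast_half, rung6_beta_23_12]
  simp

/-- The algebraic factors are positive. [folklore] -/
theorem rung6_kappa_pos (i : Fin 4) : 0 < κ i := by
  have ht : 0 < (2:ℝ) ^ (1 / 3 : ℝ) := Real.rpow_pos_of_pos two_pos _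
  have hs : 0 < Real.sqrt 3 := Real.sqrt_pos.2 (by norm_num)
  fin_cases i <;> simp <;> positivity

/-- The algebraic factors are real algebraic (`√3`, `2^{1/3}` are). [folklore] -/
theorem rung6_kappa_alg (i : Fin 4) : IsAlgebraic ℚ (κ i) := by
  have ht : IsAlgebraic ℚ ((2:ℝ) ^ (1 / 3 : ℝ)) := by
    have h := isAlgebraic_two_rpow (1 / 3)
    rwa [cast_third] at h
  have h2 : IsAlgebraic ℚ (2:ℝ) := by simpa using isAlgebraic_nat (R := ℚ) (A := ℝ) 2
  have h4 : IsAlgebraic ℚ (4:ℝ) := by simpa using (isAlgebraic_rat ℚ 4 : IsAlgebraic ℚ (((4 : ℚ)) : ℝ))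
  have h3 := isAlgebraic_sqrt_three
  fin_cases i
  · exact isAlgebraic_one
  · exact isAlgebraic_one
  · show IsAlgebraic ℚ (Real.sqrt 3 / (2 * (2:ℝ) ^ (1 / 3 : ℝ)))
    rw [div_eq_mul_inv]
    exact h3.mul (h2.mul ht).inv
  · show IsAlgebraic ℚ (4 * (2:ℝ) ^ (1 / 3 : ℝ))
    exact h4.mul ht

/-! ## Part II — the normal form of all 36 base cells and the assembly -/

/-- NORMAL FORM OF ALL BASE CELLS at level `6`, given the upper normal form: `[c·β(a,b)]`, `a, b ∈ {1/6, 1/3, 1/2, 2/3, 5/6, 1}`, is a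
chain of moves away from `(c q)·T_i`, `q > 0`, `c q` real algebraic, over the canonical cells `T₀ = [β(1,1)]`, `T₁ = [β(1/2,1/2)]`,
`T₂ = [β(1/3,1/2)]` (lower cells, `normalForm_sixths_lower`) and `T₃ = [β(2/3,1/2)]` (upper cells, the hypothesis).
[cite: KontsevichZagier2001, §1.2] -/
theorem rung6_normalForm (hU : UpperNF) {c : ℝ} (hc : IsAlgebraic ℚ c) {a b : ℚ}
    (ha : a = 1 / 6 ∨ a = 1 / 3 ∨ a = 1 / 2 ∨ a = 2 / 3 ∨ a = 5 / 6 ∨ a = 1)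
    (hb : b = 1 / 6 ∨ b = 1 / 3 ∨ b = 1 / 2 ∨ b = 2 / 3 ∨ b = 5 / 6 ∨ b = 1) {r : IntegralRep 1} (hr : Pinned⟦c, a, b, r⟧)
    (T : Fin 4 → IntegralRep 1) (hT0 : Pinned⟦(1 : ℝ), (1 : ℚ), (1 : ℚ), T 0⟧) (hT1 : Pinned⟦(1 : ℝ), (1/2 : ℚ), (1/2 : ℚ), T 1⟧)
    (hT2 : Pinned⟦(1 : ℝ), (1/3 : ℚ), (1/2 : ℚ), T 2⟧) (hT3 : Pinned⟦(1 : ℝ), (2/3 : ℚ), (1/2 : ℚ), T 3⟧) :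
    ∃ (i : Fin 4) (q : ℝ) (hk : IsAlgebraic ℚ (c * q)), 0 < q ∧ Equivalent r ((T i).constMul (c * q) hk) := by
  by_cases hlow : a + b ≤ 1 ∨ a = 1 ∨ b = 1
  · obtain ⟨i, q, hk, hq, e⟩ := normalForm_sixths_lower c hc a b ha hb hlow r ![T 0, T 1, T 2] hr hT0 hT1 hT2
    fin_cases i
    · exact ⟨0, q, hk, hq, e⟩
    · exact ⟨1, q, hk, hq, e⟩
    · exact ⟨2, q, hk, hq, e⟩
  · obtain ⟨ha4, hb4, hlt⟩ := rung6_upper_cases ha hb hlow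
    obtain ⟨q, hk, hq, e⟩ := hU c hc a b ha4 hb4 hlt r (T 3) hr hT3
    exact ⟨3, q, hk, hq, e⟩

/-- **The base of the sixth-integer sector**, given the upper normal form: `P⟦a, b, a', b'⟧` for all exponents in
`{1/6, 1/3, 1/2, 2/3, 5/6, 1}` — two cells of the same class meet at the same multiple of the same canonical cell (normal forms, the values
`κ_i v_i` of the canonical cells, cancellation of the non-zero `κ_i v_i`), cells of different classes never share a value for non-zero
algebraic constants (`Thirds.v_sep`: Chudnovsky), and the degenerate constants `c = 0` give two zero representations.
[cite: KontsevichZagier2001, §1.2] [cite: Chudnovsky1984, Ch. 7 §2 Cor. 2.3] -/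
theorem rung6_P_base_sixth (hU : UpperNF) {a b a' b' : ℚ} (ha : a = 1 / 6 ∨ a = 1 / 3 ∨ a = 1 / 2 ∨ a = 2 / 3 ∨ a = 5 / 6 ∨ a = 1)
    (hb : b = 1 / 6 ∨ b = 1 / 3 ∨ b = 1 / 2 ∨ b = 2 / 3 ∨ b = 5 / 6 ∨ b = 1)
    (ha' : a' = 1 / 6 ∨ a' = 1 / 3 ∨ a' = 1 / 2 ∨ a' = 2 / 3 ∨ a' = 5 / 6 ∨ a' = 1)
    (hb' : b' = 1 / 6 ∨ b' = 1 / 3 ∨ b' = 1 / 2 ∨ b' = 2 / 3 ∨ b' = 5 / 6 ∨ b' = 1) : P⟦a, b, a', b'⟧ := by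
  have hpos : ∀ {q : ℚ}, (q = 1 / 6 ∨ q = 1 / 3 ∨ q = 1 / 2 ∨ q = 2 / 3 ∨ q = 5 / 6 ∨ q = 1) → 0 < q := by
    rintro q (rfl | rfl | rfl | rfl | rfl | rfl) <;> norm_num
  intro c c' r r' hc hc' hr hr' hv
  have hvr := value_of_pinned hr (hpos ha) (hpos hb)
  have hvr' := value_of_pinned hr' (hpos ha') (hpos hb')
  have hBpos : ∀ {p q : ℚ}, 0 < p → 0 < q →
      0 < Real.Gamma (p:ℝ) * Real.Gamma (q:ℝ) / Real.Gamma ((p:ℝ) + (q:ℝ)) := fun {p q} hp hq => by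
    have hpR : (0:ℝ) < p := by exact_mod_cast hp
    have hqR : (0:ℝ) < q := by exact_mod_cast hq
    exact div_pos (mul_pos (Real.Gamma_pos_of_pos hpR) (Real.Gamma_pos_of_pos hqR)) (Real.Gamma_pos_of_pos (by linarith))
  -- the degenerate constants
  by_cases hc0 : c = 0
  · have hc'0 : c' = 0 := by
      have h0 : c' * (Real.Gamma (a':ℝ) * Real.Gamma (b':ℝ) / Real.Gamma ((a':ℝ) + (b':ℝ))) = 0 := by
        rw [← hvr', ← hv, hvr, hc0, zero_mul]
      exact (mul_eq_zero.1 h0).resolve_right (hBpos (hpos ha') (hpos hb')).ne'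
    have h1 : of r ∈ relations := of_mem_relations_of_eqOn_zero r fun x hx => by
      rw [hr.2 hx]
      simp [hc0]
    have h2 : of r' ∈ relations := of_mem_relations_of_eqOn_zero r' fun x hx => by
      rw [hr'.2 hx]
      simp [hc'0]
    exact relations.sub_mem h1 h2
  have hc'0 : c' ≠ 0 := by
    intro h
    have h0 : c * (Real.Gamma (a:ℝ) * Real.Gamma (b:ℝ) / Real.Gamma ((a:ℝ) + (b:ℝ))) = 0 := by
      rw [← hvr, hv, hvr', h, zero_mul]
    exact hc0 ((mul_eq_zero.1 h0).resolve_right (hBpos (hpos ha) (hpos hb)).ne')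
  -- the four canonical cells, with constant `1`
  obtain ⟨T0, hT0⟩ := exists_pinned (1 : ℝ) isAlgebraic_one (by norm_num : (0:ℚ) < 1) (by norm_num : (0:ℚ) < 1)
  obtain ⟨T1, hT1⟩ := exists_pinned (1 : ℝ) isAlgebraic_one (by norm_num : (0:ℚ) < 1/2) (by norm_num : (0:ℚ) < 1/2)
  obtain ⟨T2, hT2⟩ := exists_pinned (1 : ℝ) isAlgebraic_one (by norm_num : (0:ℚ) < 1/3) (by norm_num : (0:ℚ) < 1/2)
  obtain ⟨T3, hT3⟩ := exists_pinned (1 : ℝ) isAlgebraic_one (by norm_num : (0:ℚ) < 2/3) (by norm_num : (0:ℚ) < 1/2)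
  have hTv : ∀ i : Fin 4, (![T0, T1, T2, T3] i).value = κ i * v i := by
    intro i
    fin_cases i
    · exact rung6_value_T0 hT0
    · exact rung6_value_T1 hT1
    · exact rung6_value_T2 hT2
    · exact rung6_value_T3 hT3
  obtain ⟨i, q, hk, hq, e⟩ := rung6_normalForm hU hc ha hb hr ![T0, T1, T2, T3] hT0 hT1 hT2 hT3
  obtain ⟨i', q', hk', hq', e'⟩ := rung6_normalForm hU hc' ha' hb' hr' ![T0, T1, T2, T3] hT0 hT1 hT2 hT3
  have hval : r.value = c * q * (κ i * v i) := by rw [Equivalent.value_eq_holds e, IntegralRep.value_constMul, hTv]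
  have hval' : r'.value = c' * q' * (κ i' * v i') := by rw [Equivalent.value_eq_holds e', IntegralRep.value_constMul, hTv]
  have h : c * q * κ i * v i = c' * q' * κ i' * v i' := by
    have h₀ := hv
    rw [hval, hval'] at h₀
    linear_combination h₀
  by_cases hii : i = i'
  · -- same class: the same multiple of the same canonical cell
    subst hii
    have hcqk : c * q * κ i = c' * q' * κ i := mul_right_cancel₀ (v_pos i).ne' h
    have hcq : c * q = c' * q' := mul_right_cancel₀ (rung6_kappa_pos i).ne' hcqk
    have emid : Equivalent ((![T0, T1, T2, T3] i).constMul (c * q) hk) ((![T0, T1, T2, T3] i).constMul (c' * q') hk') :=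
      of_sub_of_mem_relations_of_eqOn rfl fun x _ => by simp only [IntegralRep.integrand_constMul, hcq]
    exact e.trans (emid.trans e'.symm)
  · -- different classes: Chudnovsky
    exfalso
    have hA : c * q * κ i ≠ 0 := mul_ne_zero (mul_ne_zero hc0 hq.ne') (rung6_kappa_pos i).ne'
    refine v_sep i i' hii (c' * q' * κ i' * (c * q * κ i)⁻¹)
      ((hk'.mul (rung6_kappa_alg i')).mul (hk.mul (rung6_kappa_alg i)).inv) ?_
    rw [← inv_mul_cancel_left₀ hA (v i), h]
    ring

/-- **`P⟦a, b, a', b'⟧` on the whole sixth-integer sector**, given the upper normal form: reduce the right pair, then the left pair, to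
level `6` (`rung6_P_of_base_left_sixth`, keeping sixth-integrality) and apply `rung6_P_base_sixth`. [folklore] -/
theorem rung6_P_all_sixth (hU : UpperNF) {a b a' b' : ℚ} (ha : 0 < a) (hb : 0 < b) (ha' : 0 < a') (hb' : 0 < b')
    (hma : ∃ m : ℤ, a = m / 6) (hmb : ∃ m : ℤ, b = m / 6) (hma' : ∃ m : ℤ, a' = m / 6) (hmb' : ∃ m : ℤ, b' = m / 6) :
    P⟦a, b, a', b'⟧ := by
  refine rung6_P_of_base_left_sixth (fun a₀ b₀ ha₀ ha₀1 hb₀ hb₀1 hma₀ hmb₀ => ?_) a b ha hb hma hmb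
  refine P_symm (rung6_P_of_base_left_sixth (a' := a₀) (b' := b₀)
    (fun a₁ b₁ ha₁ ha₁1 hb₁ hb₁1 hma₁ hmb₁ => ?_) a' b' ha' hb' hma' hmb')
  exact rung6_P_base_sixth hU (sixth_cases ha₁ ha₁1 hma₁) (sixth_cases hb₁ hb₁1 hmb₁) (sixth_cases ha₀ ha₀1 hma₀)
    (sixth_cases hb₀ hb₀1 hmb₀)

/-- **`BetaLinearSector` ON THE SIXTH-INTEGER SECTOR from the normal form of the ten upper cells** — the LEVEL-6 RUNG of crux
stmt-3897 (registered anchor `betaLinearSector_sixths_of_normalForm_upper`): granted that every upper cell `[c·β(a,b)]`,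
`a, b ∈ {1/3, 1/2, 2/3, 5/6}`, `a + b > 1`, is a chain of moves away from a positive algebraic multiple of `[β(2/3,1/2)]`, Conjecture 1 of
Kontsevich–Zagier holds for every pair of Beta integrals `[∫₀¹ t^{a-1}(1-t)^{b-1}dt]`, `[∫₀¹ c·t^{a'-1}(1-t)^{b'-1}dt]` with
`a, b, a', b' ∈ ⅙ℕ_{>0}`, `c` real algebraic, and equal values.  Inputs: the landed chains (translation, swap), the landed normal form of the
26 lower cells (`normalForm_sixths_lower`: Euler's reflection at `1/6, 1/3, 1/2`, Legendre's duplication, the CM `3`-isogeny, the half-sum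
duplication — all inside the calculus), the closed forms `B(1/3,1/2) = (√3/2^{4/3})Γ(1/3)³/π`, `B(2/3,1/2) = 2^{7/3}π²/Γ(1/3)³`, and
Chudnovsky's theorem through `Thirds.v_sep`. [cite: KontsevichZagier2001, §1.2] [cite: Chudnovsky1984, Ch. 7 §2 Cor. 2.3] -/
theorem betaLinearSector_sixths_of_normalForm_upper :
    (∀ (c : ℝ), IsAlgebraic ℚ c → ∀ (a b : ℚ),
      (a = 1 / 3 ∨ a = 1 / 2 ∨ a = 2 / 3 ∨ a = 5 / 6) → (b = 1 / 3 ∨ b = 1 / 2 ∨ b = 2 / 3 ∨ b = 5 / 6) → 1 < a + b →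
      ∀ (r T : KZ.IntegralRep 1),
      (r.domain = {x | x 0 ∈ Set.Ioo (0:ℝ) 1} ∧
        Set.EqOn r.integrand (fun x => c * (x 0) ^ ((a:ℝ) - 1) * (1 - x 0) ^ ((b:ℝ) - 1)) r.domain) →
      (T.domain = {x | x 0 ∈ Set.Ioo (0:ℝ) 1} ∧
        Set.EqOn T.integrand (fun x => (1:ℝ) * (x 0) ^ (((2/3:ℚ):ℝ) - 1) * (1 - x 0) ^ (((1/2:ℚ):ℝ) - 1)) T.domain) →
      ∃ (q : ℝ) (hk : IsAlgebraic ℚ (c * q)), 0 < q ∧ KZ.Equivalent r (T.constMul (c * q) hk)) →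
    ∀ (a b a' b' : ℚ) (c : ℝ), 0 < a → 0 < b → 0 < a' → 0 < b' → IsAlgebraic ℚ c →
    (∃ m : ℤ, a = m / 6) → (∃ m : ℤ, b = m / 6) → (∃ m : ℤ, a' = m / 6) → (∃ m : ℤ, b' = m / 6) →
    ∀ (r r' : KZ.IntegralRep 1), r.domain = {x | x 0 ∈ Set.Ioo (0:ℝ) 1} →
    Set.EqOn r.integrand (fun x => (x 0) ^ ((a:ℝ) - 1) * (1 - x 0) ^ ((b:ℝ) - 1)) r.domain →
    r'.domain = {x | x 0 ∈ Set.Ioo (0:ℝ) 1} →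
    Set.EqOn r'.integrand (fun x => c * (x 0) ^ ((a':ℝ) - 1) * (1 - x 0) ^ ((b':ℝ) - 1)) r'.domain →
    r.value = r'.value → KZ.Equivalent r r' := by
  intro hU a b a' b' c ha hb ha' hb' hc hma hmb hma' hmb' r r' hd hi hd' hi' hv
  refine rung6_P_all_sixth hU ha hb ha' hb' hma hmb hma' hmb' 1 c r r' isAlgebraic_one hc ⟨hd, fun x hx => ?_⟩ ⟨hd', hi'⟩ hv
  simp only [hi hx, one_mul]

end Summit.KontsevichZagierPeriods.FermatIsogeny.BetaLinearSector.Sixths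

end
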